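import Literature.NumberTheory.EllipticCurves.TianYuanZhang2017.GenusPeriodsParity
import Literature.NumberTheory.QuadraticFields.RedeiMatrixFourRank
import Mathlib.NumberTheory.NumberField.Basic
import Mathlib.RingTheory.AdjoinRoot
import Mathlib.Algebra.Polynomial.SpecificDegree
import HarnessLib

/-!
# A concrete genus-field family `K_d = ℚ(√−d)` for Tian–Yuan–Zhang's genus class numbers `g(d)`

HONEST FRAMING (cell `b2b-bsdres`, sub-lane «bsd-p2», run/shared/lean/b2b/bsd-rank1-residual/p2/;
seat p2-lit-1 GEN 5; door design D-CN-6, `p2/LIT-STATUS.md` row T1-M19 (H4)): DEFINITIONS WITH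
BODIES and proved API only — no named fact, nothing asserted. PURPOSE: the typed journal facts
`TianYuanZhang2017.thm11_parity_of_scriptL` / `thm12_parity_of_scriptL` (and the consequences in
`ScriptLOddOfRhoZero.lean`) quantify over an ARBITRARY family `K : ℕ → Type` of number fields with
`IsGenusFieldFamily n K` ("`K_d = ℚ(√−d)` for the positive divisors `d` of `n`",
[cite: TianYuanZhang2017, §1 (arXiv:1411.4728 chunk p0002 L78–L82): "`g(d)` the genus class
number of `ℚ(√−d)`"]); a consumer (a door deciding `Σ₁, Σ₂ (mod 2)` per `n`) must INSTANTIATE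
them at SOME such family, i.e. needs an actual Lean type family with `Field`/`NumberField`
instances. This file provides one: `GenusField d := ℚ[X]/(X² + max(d,1))` (Mathlib `AdjoinRoot`;
the `max` only keeps `d = 0`, which never occurs as a divisor, a field), with
* `finrank_genusField : [K_d : ℚ] = 2`, `root_genusField_sq : (√−d)² = −d` (`1 ≤ d`);
* `isQuadraticFieldOfSqrt_genusField : IsQuadraticFieldOfSqrt (GenusField d) (−d)` (`1 ≤ d`) — the
  hypothesis shape of the Rédei–Reichardt fact `redeiReichardt_fourTwoCard_classGroup` and of
  `odd_genusClassNumber_iff_of_redeiReichardt`;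
* `isGenusFieldFamily_genusField : IsGenusFieldFamily n GenusField` for every `n`.
So a door writes `rankOneDatum_of_index_eq_one h12 hsq h8 hρ GenusField
(isGenusFieldFamily_genusField n) hodd` and decides `hodd` divisor by divisor through Rédei.

## References
* [TianYuanZhang2017] Y. Tian, X. Yuan, S.-W. Zhang, Asian J. Math. 21 (2017), §1 (`g(d)`, `K = ℚ(√−d)`).
* Tree: `GenusPeriodsParity.lean` (`IsGenusFieldFamily`, `genusClassNumber`),
  `Tian2014/CongruentNumbersHeegnerPoints.lean` (`IsQuadraticFieldOfSqrt`).
-/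

noncomputable section

open Polynomial

namespace Literature.NumberTheory.EllipticCurves.TianYuanZhang2017

open Literature.NumberTheory.EllipticCurves.Tian2014

/-- The defining polynomial `X² + max(d, 1) ∈ ℚ[X]` of `K_d = ℚ(√−d)` (`d ≥ 1`; at `d = 0` the
harmless `X² + 1`). [cite: TianYuanZhang2017, §1 (p0002 L78–L82: K = ℚ(√−d))] -/
def genusFieldPoly (d : ℕ) : ℚ[X] :=
  X ^ 2 + C ((max d 1 : ℕ) : ℚ)

/-- `X² + max(d,1)` is monic. [cite: TianYuanZhang2017, §1 (p0002 L78–L82)] -/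
theorem monic_genusFieldPoly (d : ℕ) : (genusFieldPoly d).Monic := by
  unfold genusFieldPoly
  exact monic_X_pow_add_C _ two_ne_zero

/-- `X² + max(d,1)` has degree `2`. [cite: TianYuanZhang2017, §1 (p0002 L78–L82)] -/
theorem natDegree_genusFieldPoly (d : ℕ) : (genusFieldPoly d).natDegree = 2 := by
  unfold genusFieldPoly
  exact natDegree_X_pow_add_C

/-- `X² + c` with `c > 0` has no rational root, hence (degree `2`) is irreducible over `ℚ`.
[cite: TianYuanZhang2017, §1 (p0002 L78–L82: ℚ(√−d) is a quadratic field)] -/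
theorem irreducible_genusFieldPoly (d : ℕ) : Irreducible (genusFieldPoly d) := by
  have hmonic := monic_genusFieldPoly d
  have hdeg := natDegree_genusFieldPoly d
  rw [hmonic.irreducible_iff_roots_eq_zero_of_degree_le_three (by omega) (by omega)]
  apply Multiset.eq_zero_of_forall_notMem
  intro x hx
  rw [mem_roots hmonic.ne_zero, IsRoot, genusFieldPoly, eval_add, eval_pow, eval_X, eval_C] at hx
  have h1 : (1 : ℚ) ≤ ((max d 1 : ℕ) : ℚ) := by exact_mod_cast le_max_right d 1
  nlinarith [sq_nonneg x]

/-- Irreducibility of `X² + max(d,1)` as an instance, so that `AdjoinRoot (genusFieldPoly d)` is a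
field. [cite: TianYuanZhang2017, §1 (p0002 L78–L82)] -/
instance (d : ℕ) : Fact (Irreducible (genusFieldPoly d)) := ⟨irreducible_genusFieldPoly d⟩

/-- **The genus field `K_d = ℚ(√−d) = ℚ[X]/(X² + d)`** (`d ≥ 1`), as Mathlib's `AdjoinRoot`; a
number field of degree `2` in which `−d` is a square. An `abbrev`, so the `Field`, `Algebra ℚ`,
`NumberField` instances of `AdjoinRoot` apply. [cite: TianYuanZhang2017, §1 (p0002 L78–L82)] -/
abbrev GenusField (d : ℕ) : Type :=
  AdjoinRoot (genusFieldPoly d)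

/-- `[K_d : ℚ] = 2`. [cite: TianYuanZhang2017, §1 (p0002 L78–L82)] -/
theorem finrank_genusField (d : ℕ) : Module.finrank ℚ (GenusField d) = 2 := by
  rw [(AdjoinRoot.powerBasis (monic_genusFieldPoly d).ne_zero).finrank, AdjoinRoot.powerBasis_dim,
    natDegree_genusFieldPoly]

/-- The class of `X` in `K_d` is a square root of `−d` (`d ≥ 1`). [cite: TianYuanZhang2017, §1 (p0002 L78–L82)] -/
theorem root_genusField_sq {d : ℕ} (hd : 1 ≤ d) :
    (AdjoinRoot.root (genusFieldPoly d)) ^ 2 = -((d : ℕ) : GenusField d) := by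
  have h0 : AdjoinRoot.mk (genusFieldPoly d) (genusFieldPoly d) = 0 := AdjoinRoot.mk_self
  have h1 : AdjoinRoot.mk (genusFieldPoly d) (genusFieldPoly d) =
      (AdjoinRoot.root (genusFieldPoly d)) ^ 2 + ((max d 1 : ℕ) : GenusField d) := by
    conv_lhs => arg 2; rw [genusFieldPoly]
    rw [map_add, map_pow, AdjoinRoot.mk_X, AdjoinRoot.mk_C, map_natCast]
  rw [max_eq_left hd] at h1
  linear_combination h1.symm.trans h0

/-- `K_d` "is `ℚ(√−d)`" in the sense of `Tian2014.IsQuadraticFieldOfSqrt` (degree `2`, `−d` a square)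
— the hypothesis shape of the Rédei–Reichardt fact. [cite: TianYuanZhang2017, §1 (p0002 L78–L82)] -/
theorem isQuadraticFieldOfSqrt_genusField {d : ℕ} (hd : 1 ≤ d) :
    IsQuadraticFieldOfSqrt (GenusField d) (-(d : ℤ)) :=
  ⟨finrank_genusField d, ⟨AdjoinRoot.root _, by exact_mod_cast root_genusField_sq hd⟩⟩

/-- **`(K_d)_{d ∣ n}` is a genus-field family for every `n`** (`IsGenusFieldFamily n GenusField`):
the instantiation point for `thm11_parity_of_scriptL` / `thm12_parity_of_scriptL`.
[cite: TianYuanZhang2017, §1 (p0002 L78–L82)] -/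
theorem isGenusFieldFamily_genusField (n : ℕ) : IsGenusFieldFamily n GenusField := by
  intro d hd
  have hd1 : 1 ≤ d := Nat.pos_of_mem_divisors hd
  exact ⟨finrank_genusField d, ⟨AdjoinRoot.root _, by exact_mod_cast root_genusField_sq hd1⟩⟩

end Literature.NumberTheory.EllipticCurves.TianYuanZhang2017

end
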